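import Literature.LinearAlgebra.Matrix.PosDefGeometricMean
import Literature.LinearAlgebra.Matrix.PositiveMapKantorovichInequalities
import HarnessLib

/-!
# Ando's inequality `Φ(A ♯ B) ≤ Φ(A) ♯ Φ(B)` for unital positive linear maps, the arithmetic–geometric mean
# inequality `A ♯ B ≤ ½(A + B)`, the block characterization `[[A, A♯B], [A♯B, B]] ⪰ 0`, and the Kantorovich
# counterpart `Φ(A⁻¹) ♯ Φ(A) ≤ ((M+m)/(2√(Mm))) I`

Hodge foundations lane (`lit-hodgefound`, prover p24 gen 62; matrix-analysis series, sequel of `PosDefGeometricMean.lean`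
(Horn–Johnson 7.2.P23: the geometric mean `G(A, B) = A^{1/2}(A^{-1/2}BA^{-1/2})^{1/2}A^{1/2}`, SPELLED OUT IN PLACE as
`CFC.sqrt A * CFC.sqrt ((CFC.sqrt A)⁻¹ * B * (CFC.sqrt A)⁻¹) * CFC.sqrt A` — no definition; its positivity, the Riccati
equation `XA⁻¹X = B`, uniqueness, symmetry), `PositiveMapKadisonChoiInequalities.lean` (`Φ(A^{1/2}) ≤ Φ(A)^{1/2}`) and
`PositiveMapKantorovichInequalities.lean` ((6) `MmΦ(A⁻¹) + Φ(A) ≤ (M+m)I`)).  THEOREMS ONLY: no definition, no named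
fact, net debt 0.  Matrices over `ℂ`; `Y ≤ Z` (Loewner) is `(Z - Y).PosSemidef`; `Φ : Matrix n n ℂ →ₗ[ℂ] Matrix k k ℂ`
positive (`hΦ`) and unital (`hΦ1`).  Below `A ♯ B` abbreviates (in prose only) the spelled-out geometric mean.

## Sources, VERBATIM

* [Lin2013Kantorovich] M. Lin, J. Math. Anal. Appl. 402 (2013) 127–132 = arXiv:1212.5690 (held `paper:arxiv-1212.5690`),
  § 2 p. 4: «For `A, B > 0`, the geometric mean `A♯B` is defined by `A♯B = A^{1/2}(A^{-1/2}BA^{-1/2})^{1/2}A^{1/2}`.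
  Observing that the geometric mean is the unique positive solution to the Ricatti equation `XA⁻¹X = B`, we have
  `A♯B = B♯A`. One motivation of such a notion is of course the AM-GM inequality `(A+B)/2 ≥ A♯B`. (5) A remarkable
  property of geometric mean is the so called maximal characterization [PW75], which says that `[[A, A♯B], [A♯B, B]]`
  is positive, and moreover, if the operator matrix `[[A, X], [X, B]]`, with `X` being self-adjoint, is positive, then
  `A♯B ≥ X`. …  Thus the operator Kantorovich inequality (2) implies **Corollary 2.2.** Let `0 < m ≤ A ≤ M`. Then for
  every positive unital linear map `Φ`, `Φ(A⁻¹)♯Φ(A) ≤ (M+m)/(2√(Mm))`. (7) …  There is another way to approach (7).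
  Note that `(M − A)(m − A)A⁻¹ ≤ 0`, then `MmA⁻¹ + A ≤ M + m`, and hence `MmΦ(A⁻¹) + Φ(A) ≤ M + m`. (6)  Applying the
  AM-GM inequality (5) to the left hand side of (6), we obtain (7).»
* [SababhehEtAl2019] M. Sababheh, H. R. Moradi, I. H. Gümüş, S. Furuichi, arXiv:1911.12915 (held `paper:arxiv-1911.12915`),
  § 2 p. 4: «Let `X = A♯B` and let `Φ` be a unital positive linear map. … Consequently,
  `Φ(X) ≤ Φ(A)^{1/2}(Φ(A)^{-1/2}Φ(B)Φ(A)^{-1/2})^{1/2}Φ(A)^{1/2}`, which is equivalent to `Φ(A♯B) ≤ Φ(A)♯Φ(B)`. This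
  proves Ando's inequality.»; proof of Prop. 2.1: «define the positive unital linear mapping `Ψ` by
  `Ψ(X) ≡ Φ(A)^{-1/2}Φ(A^{1/2}XA^{1/2})Φ(A)^{-1/2}` and let `C = (A^{-1/2}BA^{-1/2})^{1/2}`.»

## What is formalized (all PROVED), and the roads

* § 1 **AM–GM (5)** **`two_smul_geometricMean_le_add`** (`2(A♯B) ≤ A + B`: `½(A+B) − A♯B = ½A^{1/2}(C^{1/2} − I)²A^{1/2}`,
  `C = A^{-1/2}BA^{-1/2}`).
* § 2 **the block matrix `[[A, A♯B], [A♯B, B]] ⪰ 0`** (`fromBlocks_geometricMean_posSemidef`; the Schur complement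
  `B − (A♯B)A⁻¹(A♯B)` vanishes by the Riccati equation).  The maximality half of [PW75] is NOT formalized here.
* § 3 **Ando's inequality** **`map_geometricMean_le`** (`Φ(A♯B) ≤ Φ(A)♯Φ(B)` for `A, B ≻ 0` and `Φ` unital positive),
  by the road of Prop. 2.1: `Ψ(Y) = Φ(A)^{-1/2}Φ(A^{1/2}YA^{1/2})Φ(A)^{-1/2}` is unital positive (`conjMap`,
  `conjMap_pos`, `conjMap_one`), so `Ψ(C^{1/2}) ≤ Ψ(C)^{1/2}` (the tree's `map_sqrt_le`), i.e.
  `Φ(A)^{-1/2}Φ(A♯B)Φ(A)^{-1/2} ≤ (Φ(A)^{-1/2}Φ(B)Φ(A)^{-1/2})^{1/2}`; conjugate by `Φ(A)^{1/2}`.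
* § 4 homogeneity `A ♯ (cB) = √c (A♯B)` (`geometricMean_smul_right`, by uniqueness of the Riccati solution) and
  **Corollary 2.2 (7)** by Lin's «another way»: **`geometricMean_map_map_inv_le`** (`Φ(A)♯Φ(A⁻¹) ≤ ((M+m)/(2√(Mm)))I`)
  and, through `A♯B = B♯A`, the printed **`geometricMean_map_inv_map_le`** (`Φ(A⁻¹)♯Φ(A) ≤ ((M+m)/(2√(Mm)))I`).
-/

noncomputable section

open Matrix
open scoped ComplexOrder MatrixOrder
open Literature.LinearAlgebra.Matrix.PosDefGeometricMean (isUnit_det_sqrt sqrt_inv_mul_mul_sqrt_inv geometricMean_posDef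
  geometricMean_mul_inv_mul eq_geometricMean geometricMean_comm conjTranspose_sqrt posDef_sqrt_inv_mul_mul_sqrt_inv)
open Literature.LinearAlgebra.Matrix.HadamardProductBlockInequalities (sqrt_posDef posSemidef_sqrt_mul_mul_sqrt)
open Literature.LinearAlgebra.Matrix.PositiveMapKadisonChoiInequalities (map_sqrt_le posDef_map)
open Literature.LinearAlgebra.Matrix.PositiveMapKantorovichInequalities (smul_map_inv_add_map_le posDef_of_sub_smul_one)

namespace Literature.LinearAlgebra.Matrix.AndoGeometricMeanInequality

variable {n k : Type*} [Fintype n] [DecidableEq n] [Fintype k] [DecidableEq k] {A B : Matrix n n ℂ}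

/-! ## § 0. Plumbing -/

omit [DecidableEq n] in
/-- `cX ⪰ 0` for a real `c ≥ 0` and `X ⪰ 0`. [folklore] -/
private theorem real_smul_posSemidef {X : Matrix n n ℂ} {c : ℝ} (hc : 0 ≤ c) (hX : X.PosSemidef) :
    ((c : ℂ) • X).PosSemidef := by
  refine PosSemidef.of_dotProduct_mulVec_nonneg ?_ fun x => ?_
  · unfold Matrix.IsHermitian
    rw [conjTranspose_smul, hX.1.eq]
    simp
  · rw [smul_mulVec, dotProduct_smul, smul_eq_mul]
    exact mul_nonneg (Complex.zero_le_real.mpr hc) (hX.dotProduct_mulVec_nonneg x)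

omit [Fintype n] [DecidableEq n] in
/-- Loewner transitivity. [folklore] -/
private theorem loewner_trans {X Y Z : Matrix n n ℂ} (h₁ : (Y - X).PosSemidef) (h₂ : (Z - Y).PosSemidef) :
    (Z - X).PosSemidef := by
  have h := h₁.add h₂
  rwa [sub_add_sub_cancel'] at h

/-- `A^{1/2}(A^{-1/2}BA^{-1/2})A^{1/2} = B` for `A ≻ 0`. [cite: Lin2013Kantorovich, § 2 (the definition of `A♯B`), p. 4] -/
theorem sqrt_mul_conj_mul_sqrt (hA : A.PosDef) (B : Matrix n n ℂ) :
    CFC.sqrt A * ((CFC.sqrt A)⁻¹ * B * (CFC.sqrt A)⁻¹) * CFC.sqrt A = B := by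
  have hSu : IsUnit (CFC.sqrt A).det := isUnit_det_sqrt hA
  have h1 : CFC.sqrt A * (CFC.sqrt A)⁻¹ = 1 := mul_nonsing_inv _ hSu
  have h2 : (CFC.sqrt A)⁻¹ * CFC.sqrt A = 1 := nonsing_inv_mul _ hSu
  calc CFC.sqrt A * ((CFC.sqrt A)⁻¹ * B * (CFC.sqrt A)⁻¹) * CFC.sqrt A
      = (CFC.sqrt A * (CFC.sqrt A)⁻¹) * B * ((CFC.sqrt A)⁻¹ * CFC.sqrt A) := by simp only [Matrix.mul_assoc]
    _ = B := by rw [h1, h2, Matrix.one_mul, Matrix.mul_one]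

/-! ## § 1. The arithmetic–geometric mean inequality (5): `A♯B ≤ ½(A + B)` -/

/-- **AM–GM (5): `2(A♯B) ≤ A + B`** for `A, B ≻ 0` («`(A+B)/2 ≥ A♯B`»): with `S = A^{1/2}`, `C = S⁻¹BS⁻¹`, `R = C^{1/2}`,
`A + B − 2SRS = S(C − 2R + I)S = S(R − I)²S ⪰ 0`. [cite: Lin2013Kantorovich, (5), p. 4] -/
theorem two_smul_geometricMean_le_add (hA : A.PosDef) (hB : B.PosDef) :
    (A + B - (2 : ℂ) • (CFC.sqrt A * CFC.sqrt ((CFC.sqrt A)⁻¹ * B * (CFC.sqrt A)⁻¹) * CFC.sqrt A)).PosSemidef := by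
  have hC : ((CFC.sqrt A)⁻¹ * B * (CFC.sqrt A)⁻¹).PosDef := posDef_sqrt_inv_mul_mul_sqrt_inv hA hB
  have hB' : B = CFC.sqrt A * ((CFC.sqrt A)⁻¹ * B * (CFC.sqrt A)⁻¹) * CFC.sqrt A := (sqrt_mul_conj_mul_sqrt hA B).symm
  set C := (CFC.sqrt A)⁻¹ * B * (CFC.sqrt A)⁻¹ with hCdef
  set S := CFC.sqrt A with hSdef
  have hSh : Sᴴ = S := conjTranspose_sqrt A
  have hSS : S * S = A := CFC.sqrt_mul_sqrt_self A hA.posSemidef.nonneg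
  have hRh : (CFC.sqrt C)ᴴ = CFC.sqrt C := conjTranspose_sqrt C
  have hRR : CFC.sqrt C * CFC.sqrt C = C := CFC.sqrt_mul_sqrt_self C hC.posSemidef.nonneg
  have hsq : ((CFC.sqrt C - 1) * (CFC.sqrt C - 1)).PosSemidef := by
    have h := posSemidef_conjTranspose_mul_self (CFC.sqrt C - 1)
    rwa [conjTranspose_sub, conjTranspose_one, hRh] at h
  have h := hsq.mul_mul_conjTranspose_same S
  rw [hSh] at h
  have eRR : (CFC.sqrt C - 1) * (CFC.sqrt C - 1) = C - (2 : ℂ) • CFC.sqrt C + 1 := by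
    rw [Matrix.sub_mul, Matrix.mul_sub, Matrix.one_mul, Matrix.mul_one, hRR, two_smul]
    abel
  have e : S * ((CFC.sqrt C - 1) * (CFC.sqrt C - 1)) * S = A + B - (2 : ℂ) • (S * CFC.sqrt C * S) := by
    rw [eRR, hB', ← hSS]
    simp only [Matrix.mul_add, Matrix.mul_sub, Matrix.add_mul, Matrix.sub_mul, Matrix.mul_smul, Matrix.smul_mul,
      Matrix.mul_one, Matrix.mul_assoc]
    abel
  rwa [e] at h

/-! ## § 2. The block matrix `[[A, A♯B], [A♯B, B]]` is positive semidefinite -/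

/-- **«`[[A, A♯B], [A♯B, B]]` is positive»** for `A, B ≻ 0` (Schur complement: `B − (A♯B)A⁻¹(A♯B) = 0` by the Riccati
equation). [cite: Lin2013Kantorovich, § 2 (maximal characterization [PW75], first half), p. 4] -/
theorem fromBlocks_geometricMean_posSemidef (hA : A.PosDef) (hB : B.PosDef) :
    (Matrix.fromBlocks A (CFC.sqrt A * CFC.sqrt ((CFC.sqrt A)⁻¹ * B * (CFC.sqrt A)⁻¹) * CFC.sqrt A)
      (CFC.sqrt A * CFC.sqrt ((CFC.sqrt A)⁻¹ * B * (CFC.sqrt A)⁻¹) * CFC.sqrt A) B).PosSemidef := by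
  have hG := geometricMean_posDef hA hB
  letI : Invertible A := hA.isUnit.invertible
  have h := (PosDef.fromBlocks₁₁ (CFC.sqrt A * CFC.sqrt ((CFC.sqrt A)⁻¹ * B * (CFC.sqrt A)⁻¹) * CFC.sqrt A) B hA).mpr
  rw [hG.1.eq] at h
  refine h ?_
  rw [geometricMean_mul_inv_mul hA hB, sub_self]
  exact PosSemidef.zero

/-! ## § 3. Ando's inequality `Φ(A♯B) ≤ Φ(A)♯Φ(B)` -/

section Maps

variable (Φ : Matrix n n ℂ →ₗ[ℂ] Matrix k k ℂ)

/-- The conjugated map `Y ↦ Q·Φ(SYS)·Q` (for Prop. 2.1's `Ψ(X) = Φ(A)^{-1/2}Φ(A^{1/2}XA^{1/2})Φ(A)^{-1/2}` take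
`S = A^{1/2}`, `Q = Φ(A)^{-1/2}`). [cite: SababhehEtAl2019, proof of Prop. 2.1, p. 4] -/
theorem conjMap_apply (S : Matrix n n ℂ) (Q : Matrix k k ℂ) (Y : Matrix n n ℂ) :
    ((LinearMap.mulLeft ℂ Q).comp ((LinearMap.mulRight ℂ Q).comp (Φ.comp ((LinearMap.mulLeft ℂ S).comp
      (LinearMap.mulRight ℂ S))))) Y = Q * Φ (S * Y * S) * Q := by
  simp only [LinearMap.comp_apply, LinearMap.mulLeft_apply, LinearMap.mulRight_apply, Matrix.mul_assoc]

/-- `Ψ` is positive when `Φ` is and `S`, `Q` are Hermitian. [cite: SababhehEtAl2019, proof of Prop. 2.1 («the positive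
unital linear mapping `Ψ`»), p. 4] -/
theorem conjMap_pos (hΦ : ∀ X, X.PosSemidef → (Φ X).PosSemidef) {S : Matrix n n ℂ} {Q : Matrix k k ℂ}
    (hS : S.IsHermitian) (hQ : Q.IsHermitian) (Y : Matrix n n ℂ) (hY : Y.PosSemidef) :
    (((LinearMap.mulLeft ℂ Q).comp ((LinearMap.mulRight ℂ Q).comp (Φ.comp ((LinearMap.mulLeft ℂ S).comp
      (LinearMap.mulRight ℂ S))))) Y).PosSemidef := by
  rw [conjMap_apply]
  have h1 : (S * Y * S).PosSemidef := by
    have h := hY.conjTranspose_mul_mul_same S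
    rwa [hS.eq] at h
  have h2 := (hΦ _ h1).conjTranspose_mul_mul_same Q
  rwa [hQ.eq] at h2

/-- `Ψ` is unital: `Φ(A)^{-1/2}Φ(A^{1/2}·I·A^{1/2})Φ(A)^{-1/2} = I` (`A ≻ 0`, `Φ` unital positive).
[cite: SababhehEtAl2019, proof of Prop. 2.1, p. 4] -/
theorem conjMap_one (hΦ : ∀ X, X.PosSemidef → (Φ X).PosSemidef) (hΦ1 : Φ 1 = 1) (hA : A.PosDef) :
    ((LinearMap.mulLeft ℂ (CFC.sqrt (Φ A))⁻¹).comp ((LinearMap.mulRight ℂ (CFC.sqrt (Φ A))⁻¹).comp (Φ.comp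
      ((LinearMap.mulLeft ℂ (CFC.sqrt A)).comp (LinearMap.mulRight ℂ (CFC.sqrt A)))))) 1 = 1 := by
  rw [conjMap_apply, Matrix.mul_one, CFC.sqrt_mul_sqrt_self A hA.posSemidef.nonneg]
  exact sqrt_inv_mul_mul_sqrt_inv (posDef_map Φ hΦ hΦ1 hA)

/-- **Ando's inequality: `Φ(A♯B) ≤ Φ(A)♯Φ(B)`** for `A, B ≻ 0` and every unital positive linear map `Φ` between matrix
algebras (geometric means spelled out: `X♯Y = X^{1/2}(X^{-1/2}YX^{-1/2})^{1/2}X^{1/2}`).  Road: with the unital positive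
`Ψ(Y) = Φ(A)^{-1/2}Φ(A^{1/2}YA^{1/2})Φ(A)^{-1/2}` and `C = A^{-1/2}BA^{-1/2}`, `Ψ(C^{1/2}) ≤ Ψ(C)^{1/2}` (the tree's
`map_sqrt_le`) reads `Φ(A)^{-1/2}Φ(A♯B)Φ(A)^{-1/2} ≤ (Φ(A)^{-1/2}Φ(B)Φ(A)^{-1/2})^{1/2}`; conjugate by `Φ(A)^{1/2}`.
[cite: SababhehEtAl2019, § 2 («This proves Ando's inequality»), p. 4] -/
theorem map_geometricMean_le (hΦ : ∀ X, X.PosSemidef → (Φ X).PosSemidef) (hΦ1 : Φ 1 = 1) (hA : A.PosDef)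
    (hB : B.PosDef) :
    (CFC.sqrt (Φ A) * CFC.sqrt ((CFC.sqrt (Φ A))⁻¹ * Φ B * (CFC.sqrt (Φ A))⁻¹) * CFC.sqrt (Φ A) -
      Φ (CFC.sqrt A * CFC.sqrt ((CFC.sqrt A)⁻¹ * B * (CFC.sqrt A)⁻¹) * CFC.sqrt A)).PosSemidef := by
  have hΦA : (Φ A).PosDef := posDef_map Φ hΦ hΦ1 hA
  have hQpd : (CFC.sqrt (Φ A)).PosDef := sqrt_posDef hΦA
  have hQh : (CFC.sqrt (Φ A))ᴴ = CFC.sqrt (Φ A) := conjTranspose_sqrt (Φ A)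
  have hQih : ((CFC.sqrt (Φ A))⁻¹).IsHermitian := hQpd.inv.1
  have hQu : IsUnit (CFC.sqrt (Φ A)).det := isUnit_det_sqrt hΦA
  have hq1 : CFC.sqrt (Φ A) * (CFC.sqrt (Φ A))⁻¹ = 1 := mul_nonsing_inv _ hQu
  have hq2 : (CFC.sqrt (Φ A))⁻¹ * CFC.sqrt (Φ A) = 1 := nonsing_inv_mul _ hQu
  have hSh : (CFC.sqrt A).IsHermitian := (conjTranspose_sqrt A)
  have hC : ((CFC.sqrt A)⁻¹ * B * (CFC.sqrt A)⁻¹).PosDef := posDef_sqrt_inv_mul_mul_sqrt_inv hA hB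
  -- the unital positive map `Ψ`
  set Ψ := (LinearMap.mulLeft ℂ (CFC.sqrt (Φ A))⁻¹).comp ((LinearMap.mulRight ℂ (CFC.sqrt (Φ A))⁻¹).comp (Φ.comp
      ((LinearMap.mulLeft ℂ (CFC.sqrt A)).comp (LinearMap.mulRight ℂ (CFC.sqrt A))))) with hΨ
  have hΨpos : ∀ X, X.PosSemidef → (Ψ X).PosSemidef := fun X hX => conjMap_pos Φ hΦ hSh hQih X hX
  have hΨ1 : Ψ 1 = 1 := conjMap_one Φ hΦ hΦ1 hA
  have h := map_sqrt_le Ψ hΨpos hΨ1 hC.posSemidef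
  rw [hΨ, conjMap_apply, conjMap_apply, sqrt_mul_conj_mul_sqrt hA B] at h
  -- conjugate by `Q = Φ(A)^{1/2}`
  have h2 := h.mul_mul_conjTranspose_same (CFC.sqrt (Φ A))
  rw [hQh, Matrix.mul_sub, Matrix.sub_mul] at h2
  convert h2 using 2
  simp only [← Matrix.mul_assoc, hq1, Matrix.one_mul]
  simp only [Matrix.mul_assoc, hq2, Matrix.mul_one]

/-! ## § 4. Homogeneity and the Kantorovich counterpart (7): `Φ(A⁻¹)♯Φ(A) ≤ ((M+m)/(2√(Mm))) I` -/

omit [Fintype k] [DecidableEq k] in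
/-- Homogeneity in the second argument: `A ♯ (cB) = √c (A♯B)` for `c > 0` (`√c(A♯B)` is a positive solution of
`XA⁻¹X = cB`; uniqueness of the Riccati solution). [cite: Lin2013Kantorovich, § 2 («the geometric mean is the unique
positive solution to the Ricatti equation `XA⁻¹X = B`»), p. 4] -/
theorem geometricMean_smul_right (hA : A.PosDef) (hB : B.PosDef) {c : ℝ} (hc : 0 < c) :
    CFC.sqrt A * CFC.sqrt ((CFC.sqrt A)⁻¹ * ((c : ℂ) • B) * (CFC.sqrt A)⁻¹) * CFC.sqrt A =
      ((Real.sqrt c : ℝ) : ℂ) • (CFC.sqrt A * CFC.sqrt ((CFC.sqrt A)⁻¹ * B * (CFC.sqrt A)⁻¹) * CFC.sqrt A) := by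
  have hG := geometricMean_posDef hA hB
  have hcB : ((c : ℂ) • B).PosDef := by
    have h := hB.smul (Complex.zero_lt_real.mpr hc)
    exact h
  have hX : (((Real.sqrt c : ℝ) : ℂ) • (CFC.sqrt A * CFC.sqrt ((CFC.sqrt A)⁻¹ * B * (CFC.sqrt A)⁻¹) *
      CFC.sqrt A)).PosSemidef := real_smul_posSemidef (Real.sqrt_nonneg c) hG.posSemidef
  refine (eq_geometricMean hA hcB hX ?_).symm
  rw [Matrix.smul_mul, Matrix.smul_mul, Matrix.mul_smul, smul_smul, geometricMean_mul_inv_mul hA hB,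
    ← Complex.ofReal_mul, Real.mul_self_sqrt hc.le]

/-- **(7), symmetric orientation: `Φ(A)♯Φ(A⁻¹) ≤ ((M+m)/(2√(Mm))) I`** for `0 < m ≤ A ≤ M` and `Φ` unital positive, by
Lin's «another way»: AM–GM (5) applied to (6) `MmΦ(A⁻¹) + Φ(A) ≤ (M+m)I`, and `Φ(A)♯(MmΦ(A⁻¹)) = √(Mm)(Φ(A)♯Φ(A⁻¹))`.
[cite: Lin2013Kantorovich, Cor. 2.2 (7) and «There is another way to approach (7)», p. 4] -/
theorem geometricMean_map_map_inv_le (hΦ : ∀ X, X.PosSemidef → (Φ X).PosSemidef) (hΦ1 : Φ 1 = 1) {m M : ℝ}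
    (hm : 0 < m) (hmM : m ≤ M) (hmA : (A - (m : ℂ) • (1 : Matrix n n ℂ)).PosSemidef)
    (hAM : ((M : ℂ) • (1 : Matrix n n ℂ) - A).PosSemidef) :
    ((((M + m) / (2 * Real.sqrt (M * m)) : ℝ) : ℂ) • (1 : Matrix k k ℂ) -
      CFC.sqrt (Φ A) * CFC.sqrt ((CFC.sqrt (Φ A))⁻¹ * Φ A⁻¹ * (CFC.sqrt (Φ A))⁻¹) * CFC.sqrt (Φ A)).PosSemidef := by
  have hMm : 0 < M * m := mul_pos (hm.trans_le hmM) hm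
  have hs : 0 < Real.sqrt (M * m) := Real.sqrt_pos.mpr hMm
  have hA : A.PosDef := posDef_of_sub_smul_one hm hmA
  have hX : (Φ A).PosDef := posDef_map Φ hΦ hΦ1 hA
  have hY : (Φ A⁻¹).PosDef := posDef_map Φ hΦ hΦ1 hA.inv
  -- AM–GM for `(Φ(A), MmΦ(A⁻¹))` and (6)
  have h1 := two_smul_geometricMean_le_add hX (hY.smul (Complex.zero_lt_real.mpr hMm))
  rw [geometricMean_smul_right hX hY hMm, smul_smul] at h1
  have h6 := smul_map_inv_add_map_le Φ hΦ hΦ1 hm hmM hmA hAM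
  have h6' : (((M + m : ℝ) : ℂ) • (1 : Matrix k k ℂ) - (Φ A + ((M * m : ℝ) : ℂ) • Φ A⁻¹)).PosSemidef := by
    rw [add_comm (Φ A)]
    exact h6
  have h2 := loewner_trans h1 h6'
  -- divide by `2√(Mm) > 0`
  have h3 := real_smul_posSemidef (inv_nonneg.mpr (mul_pos two_pos hs).le) h2
  rw [smul_sub, smul_smul, smul_smul, ← Complex.ofReal_ofNat, ← Complex.ofReal_mul, ← Complex.ofReal_mul,
    ← Complex.ofReal_mul, inv_mul_cancel₀ (mul_pos two_pos hs).ne', Complex.ofReal_one, one_smul,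
    inv_mul_eq_div] at h3
  exact h3

/-- **Corollary 2.2 (7), as printed: `Φ(A⁻¹)♯Φ(A) ≤ ((M+m)/(2√(Mm))) I`** for `0 < m ≤ A ≤ M` and every positive unital
linear map `Φ` (`A♯B = B♯A`, the tree's `geometricMean_comm`). [cite: Lin2013Kantorovich, Corollary 2.2 (7), p. 4]
[cite: SababhehEtAl2019, Theorem 3.1 (iii), p. 5] -/
theorem geometricMean_map_inv_map_le (hΦ : ∀ X, X.PosSemidef → (Φ X).PosSemidef) (hΦ1 : Φ 1 = 1) {m M : ℝ}
    (hm : 0 < m) (hmM : m ≤ M) (hmA : (A - (m : ℂ) • (1 : Matrix n n ℂ)).PosSemidef)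
    (hAM : ((M : ℂ) • (1 : Matrix n n ℂ) - A).PosSemidef) :
    ((((M + m) / (2 * Real.sqrt (M * m)) : ℝ) : ℂ) • (1 : Matrix k k ℂ) -
      CFC.sqrt (Φ A⁻¹) * CFC.sqrt ((CFC.sqrt (Φ A⁻¹))⁻¹ * Φ A * (CFC.sqrt (Φ A⁻¹))⁻¹) * CFC.sqrt (Φ A⁻¹)).PosSemidef := by
  have hA : A.PosDef := posDef_of_sub_smul_one hm hmA
  rw [geometricMean_comm (posDef_map Φ hΦ hΦ1 hA.inv) (posDef_map Φ hΦ hΦ1 hA)]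
  exact geometricMean_map_map_inv_le Φ hΦ hΦ1 hm hmM hmA hAM

end Maps

end Literature.LinearAlgebra.Matrix.AndoGeometricMeanInequality
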